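import Summits.KontsevichZagierPeriods.KontsevichZagierPeriods.Theses.HeckeMultiplicityOne

/-!
# KontsevichZagierPeriods / HeckeMultiplicityOne — the glue `ModularSectorGlue` (stmt-KontsevichZagierPeriods-14622)

Route `KontsevichZagierPeriods/HeckeMultiplicityOne` (multiplicity one certifies Manin ratios; Conjecture 1
in commensurability form), support item stmt-KontsevichZagierPeriods-14622 (`ModularSectorGlue`):

  `ModularSectorRemainder → DeltaRatioHecke → DeltaRatioStokes → Commensurability`.

Informal content.  The route's crux-only deciding theorem `closes` (in the route file, proved) already
turns the two typed modular-sector cruxes `DeltaRatioHecke`, `DeltaRatioStokes` and the complementary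
crux `ModularSectorRemainder` into the summit statement: the sector cruxes put both generators of the
enlarging set of `ModularSectorRemainder` inside `KZ.relations`, so the enlargement
`KZ.relations ⊔ closure{…}` collapses to `KZ.relations` and Conjecture 1 (`KZ.Equivalent r r'`, i.e.
`[r] − [r'] ∈ KZ.relations` for equal-valued KZ-rational `r`, `r'`) follows.  The target
`Commensurability` asks only for NONZERO integers `a`, `b` with `a·[r] − b·[r'] ∈ KZ.relations`;
take `a = b = 1`.

The three antecedents are the route's cruxes (items 14621, 4688, 4689) and are NOT discharged here:
the theorem is the implication, nothing more.

References: M. Kontsevich, D. Zagier, *Periods* (2001), §1.2 (Conjecture 1, the three rules);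
A. Huber, S. Müller-Stach, *Periods and Nori Motives* (2017), Ch. 13.
-/

namespace Summit.KontsevichZagierPeriods.HeckeMultiplicityOne

open Literature.NumberTheory.Transcendental
open Summit.KontsevichZagierPeriods.KontsevichZagierPeriods.Theses.HeckeMultiplicityOne

/-- **Glue of route HeckeMultiplicityOne** (settles stmt-KontsevichZagierPeriods-14622):
`ModularSectorRemainder → DeltaRatioHecke → DeltaRatioStokes → Commensurability`.  The deciding
theorem `closes` of the route file gives, from the three cruxes, `KZ.Equivalent r r'`
(`[r] − [r'] ∈ KZ.relations`) for any two KZ-rational representations `r`, `r'` of equal value;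
`Commensurability` follows with `a = b = 1` (`one_smul`).  Pure logic over the route's own
declarations. [Kontsevich–Zagier 2001, §1.2] [folklore] -/
theorem modularSectorGlue_proof :
    Summit.KontsevichZagierPeriods.KontsevichZagierPeriods.Theses.HeckeMultiplicityOne.ModularSectorGlue := by
  unfold Summit.KontsevichZagierPeriods.KontsevichZagierPeriods.Theses.HeckeMultiplicityOne.ModularSectorGlue
  intro hR h₁ h₂ n m r r' hr hr' hv
  refine ⟨1, 1, one_ne_zero, one_ne_zero, ?_⟩
  have h : KZ.Equivalent r r' := closes h₁ h₂ hR r r' hr hr' hv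
  rw [one_smul, one_smul]
  exact h

end Summit.KontsevichZagierPeriods.HeckeMultiplicityOne
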